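import Literature.Probability.RandomPlanarGeometry.LoewnerCotArgExit
import HarnessLib

/-!
# The centred Loewner flow `zₜ = gₜ(z) - Wₜ` in integrated form (pathwise)

Trunk T-STOCH; layer 5b (deterministic Loewner calculus) of the decomposition of the space-filling
phase of SLE_κ (`Literature.Probability.RandomPlanarGeometry.ae_isSpaceFilling_sleTrace_of_eight_le`;
Rohde–Schramm, Ann. Math. 161 (2005), Cor. 7.4 + Update), serving the Itô step of **Lemma 6.3**
(`Literature.Probability.RandomPlanarGeometry.sle_martingale_rsObservable`, layer 4c). The printed
sentence "A direct application of Itô's formula shows that `Mₜ := (ŷ |gₜ'(ẑ)|/yₜ)^a Ĝ(zₜ)` is a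
local martingale" (p. 904) starts from the dynamics of `zₜ = xₜ + i yₜ := gₜ(ẑ) - ξ(t)`,
`dzₜ = 2 dt / zₜ - dξₜ` (eq. (2.1)/(3.8): `∂ₜ g = 2/(g - ξ)`), and of
`ψₜ = ŷ |gₜ'(ẑ)| / yₜ`, `∂ₜ log ψₜ = 4 yₜ²/|zₜ|⁴` ((3.9), (6.3)). This file records these dynamics
**pathwise, for every continuous driving function `W`**, in the integrated form consumed by the
tree's Itô calculus (`Literature.Analysis.FunctionSpaces.IsItoProcess`: `X t = X 0 + ∫₀ᵗ b ds + Jₜ`):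
for `z ∈ ℍ` and `t < T_z`,

* `xₜ = Re z - Wₜ + ∫₀ᵗ 2 xₛ / |zₛ|² ds` (`re_centredMap_eq`) — the finite-variation part of
  `dxₜ = (2xₜ/|zₜ|²) dt - dWₜ`;
* `yₜ = Im z - ∫₀ᵗ 2 yₛ / |zₛ|² ds` (`im_centredMap_eq`) and
  `1/yₜ = 1/Im z + ∫₀ᵗ 2 / (yₛ |zₛ|²) ds` (`inv_im_centredMap_eq`) — `y` is `C¹` and decreasing;
* `ψₜ^a = 1 + ∫₀ᵗ a ψₛ^a (4 yₛ²/|zₛ|⁴) ds` for every real `a` (`derivRatio_rpow_eq`) — from (6.3),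
  `ψₜ = exp ∫₀ᵗ 4y²/|z|⁴` (`Loewner.derivRatio_eq_exp`, layer 4a).

All integrands are continuous on `[0, t]` (the solution stays off the driving function and in
`ℍ`), and real time `s` is read through `Real.toNNReal` as everywhere in the tree.

## References

* S. Rohde, O. Schramm, *Basic properties of SLE*, Ann. of Math. 161 (2005) 883–924: eq. (2.1),
  (3.8), (3.9) (pp. 887, 891), proof of Lemma 6.3, eq. (6.3) (p. 904).
* G. F. Lawler, *Conformally Invariant Processes in the Plane*, AMS (2005), Ch. 4, §4.1, eq. (4.4).
-/

noncomputable section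

open Set Filter Topology MeasureTheory Complex intervalIntegral
open scoped NNReal

namespace Literature.Probability.RandomPlanarGeometry

namespace Loewner

variable {W : ℝ≥0 → ℝ} {z : ℂ} {g : ℝ → ℂ} {T : WithTop ℝ≥0}

/-! ### Derivatives of `Re g`, `Im g`, `(Im g)⁻¹` along a solution -/

/-- `Re (2/Z) = 2 Re Z / ‖Z‖²`. [folklore] -/
theorem re_two_div (Z : ℂ) : (2 / Z).re = 2 * Z.re / ‖Z‖ ^ 2 := by
  rw [div_re, ← normSq_eq_norm_sq]
  simp

/-- `Im (2/Z) = -(2 Im Z / ‖Z‖²)`. [folklore] -/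
theorem im_two_div (Z : ℂ) : (2 / Z).im = -(2 * Z.im / ‖Z‖ ^ 2) := by
  rw [div_im, ← normSq_eq_norm_sq]
  simp

/-- Along a solution, `∂ₛ Re g = 2 Re(g - W)/|g - W|²` at interior times. [folklore] -/
theorem IsSolution.hasDerivAt_re_interior (h : IsSolution W z g T) {u : ℝ} (hu0 : 0 < u)
    (huT : (u.toNNReal : WithTop ℝ≥0) < T) :
    HasDerivAt (fun s ↦ (g s).re)
      (2 * (g u - W u.toNNReal).re / ‖g u - (W u.toNNReal : ℂ)‖ ^ 2) u := by
  have h2 : HasDerivAt (fun s ↦ (g s).re) (reCLM (vectorField W u (g u))) u :=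
    reCLM.hasFDerivAt.comp_hasDerivAt u (h.hasDerivAt hu0 huT)
  rwa [reCLM_apply, vectorField_apply, re_two_div] at h2

/-- Along a solution, `∂ₛ Im g = -2 Im(g - W)/|g - W|²` at interior times. [folklore] -/
theorem IsSolution.hasDerivAt_im_interior (h : IsSolution W z g T) {u : ℝ} (hu0 : 0 < u)
    (huT : (u.toNNReal : WithTop ℝ≥0) < T) :
    HasDerivAt (fun s ↦ (g s).im)
      (-(2 * (g u - W u.toNNReal).im / ‖g u - (W u.toNNReal : ℂ)‖ ^ 2)) u := by
  have h2 : HasDerivAt (fun s ↦ (g s).im) (imCLM (vectorField W u (g u))) u :=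
    imCLM.hasFDerivAt.comp_hasDerivAt u (h.hasDerivAt hu0 huT)
  rwa [imCLM_apply, vectorField_apply, im_two_div] at h2

/-! ### The centred flow in integrated form -/

section Integrated

variable (hW : Continuous W) (hz : 0 < z.im)
include hW hz

/-- **`xₜ = Re z - Wₜ + ∫₀ᵗ 2xₛ/|zₛ|² ds`** for `z ∈ ℍ`, `t < T_z`, `zₛ = xₛ + i yₛ = gₛ(z) - Wₛ`
(`centredMap`): the finite-variation part of `dxₜ = (2xₜ/|zₜ|²) dt - dWₜ`, i.e. the real part of
`∂ₜ gₜ(z) = 2/(gₜ(z) - Wₜ)` integrated (fundamental theorem of calculus along the solution).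
Rohde–Schramm (2005), eq. (2.1) and proof of Lemma 6.3 (`zₜ := gₜ(ẑ) - ξ(t)`, p. 904).
[cite: RohdeSchramm2005, Lemma 6.3] -/
theorem re_centredMap_eq {t : ℝ≥0} (ht : (t : WithTop ℝ≥0) < swallowingTime W z) :
    (centredMap W t z).re = z.re - W t +
      ∫ s in (0 : ℝ)..t, 2 * (centredMap W s.toNNReal z).re / ‖centredMap W s.toNNReal z‖ ^ 2 := by
  have hzW : z ≠ W 0 := ne_driving_of_im_pos hz 0
  obtain ⟨g, hg⟩ := exists_isSolution_swallowingTime_holds hW hzW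
  have ht' : ((t : ℝ).toNNReal : WithTop ℝ≥0) < swallowingTime W z := by simpa using ht
  have hsub := Icc_subset_timeDomain ht'
  set G : ℝ → ℝ := fun s ↦ (g s).re with hG
  set G' : ℝ → ℝ := fun s ↦ 2 * (g s - W s.toNNReal).re / ‖g s - (W s.toNNReal : ℂ)‖ ^ 2 with hG'
  have hWc : Continuous fun s : ℝ ↦ (W s.toNNReal : ℂ) :=
    continuous_ofReal.comp (hW.comp continuous_real_toNNReal)
  have hZ : ContinuousOn (fun s ↦ g s - (W s.toNNReal : ℂ)) (Icc 0 t) :=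
    (hg.continuousOn.mono hsub).sub hWc.continuousOn
  have hne : ∀ s ∈ Icc (0 : ℝ) t, g s - (W s.toNNReal : ℂ) ≠ 0 := fun s hs ↦
    sub_ne_zero.2 (hg.ne hs.1 (hsub hs).2)
  have hcont : ContinuousOn G (Icc 0 t) := continuous_re.comp_continuousOn (hg.continuousOn.mono hsub)
  have hderiv : ∀ s ∈ Ioo (0 : ℝ) t, HasDerivAt G (G' s) s := fun s hs ↦
    hg.hasDerivAt_re_interior hs.1 (hsub ⟨hs.1.le, hs.2.le⟩).2
  have hcont' : ContinuousOn G' (Icc 0 t) :=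
    (continuousOn_const.mul (continuous_re.comp_continuousOn hZ)).div (hZ.norm.pow 2)
      fun s hs ↦ pow_ne_zero 2 (norm_ne_zero_iff.2 (hne s hs))
  have hFTC := integral_eq_sub_of_hasDerivAt_of_le (NNReal.coe_nonneg t) hcont hderiv
    (hcont'.intervalIntegrable_of_Icc (NNReal.coe_nonneg t))
  have hcongr : ∫ s in (0 : ℝ)..t, 2 * (centredMap W s.toNNReal z).re / ‖centredMap W s.toNNReal z‖ ^ 2 =
      ∫ s in (0 : ℝ)..t, G' s := by
    refine integral_congr fun s hs ↦ ?_
    rw [uIcc_of_le (NNReal.coe_nonneg t)] at hs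
    have hsT : (s.toNNReal : WithTop ℝ≥0) < swallowingTime W z := (hsub hs).2
    simp only [hG']
    rw [centredMap_eq_of_isSolution hW hg hsT, Real.coe_toNNReal _ hs.1]
  have hG0 : G 0 = z.re := by simp [hG, hg.1]
  rw [hcongr, hFTC, hG0, centredMap_eq_of_isSolution hW hg ht]
  simp only [hG, sub_re, ofReal_re]
  ring

/-- **`yₜ = Im z - ∫₀ᵗ 2yₛ/|zₛ|² ds`** for `z ∈ ℍ`, `t < T_z` (the imaginary part of the Loewner
equation integrated; `y` is `C¹` and non-increasing). Rohde–Schramm (2005), proof of Lemma 6.3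
(`dzₜ = 2dt/zₜ - dξ`), eq. (3.8). [cite: RohdeSchramm2005, Lemma 6.3] -/
theorem im_centredMap_eq {t : ℝ≥0} (ht : (t : WithTop ℝ≥0) < swallowingTime W z) :
    (centredMap W t z).im = z.im -
      ∫ s in (0 : ℝ)..t, 2 * (centredMap W s.toNNReal z).im / ‖centredMap W s.toNNReal z‖ ^ 2 := by
  have hzW : z ≠ W 0 := ne_driving_of_im_pos hz 0
  obtain ⟨g, hg⟩ := exists_isSolution_swallowingTime_holds hW hzW
  have ht' : ((t : ℝ).toNNReal : WithTop ℝ≥0) < swallowingTime W z := by simpa using ht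
  have hsub := Icc_subset_timeDomain ht'
  set G : ℝ → ℝ := fun s ↦ (g s).im with hG
  set G' : ℝ → ℝ := fun s ↦ -(2 * (g s - W s.toNNReal).im / ‖g s - (W s.toNNReal : ℂ)‖ ^ 2)
    with hG'
  have hWc : Continuous fun s : ℝ ↦ (W s.toNNReal : ℂ) :=
    continuous_ofReal.comp (hW.comp continuous_real_toNNReal)
  have hZ : ContinuousOn (fun s ↦ g s - (W s.toNNReal : ℂ)) (Icc 0 t) :=
    (hg.continuousOn.mono hsub).sub hWc.continuousOn
  have hne : ∀ s ∈ Icc (0 : ℝ) t, g s - (W s.toNNReal : ℂ) ≠ 0 := fun s hs ↦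
    sub_ne_zero.2 (hg.ne hs.1 (hsub hs).2)
  have hcont : ContinuousOn G (Icc 0 t) := continuous_im.comp_continuousOn (hg.continuousOn.mono hsub)
  have hderiv : ∀ s ∈ Ioo (0 : ℝ) t, HasDerivAt G (G' s) s := fun s hs ↦
    hg.hasDerivAt_im_interior hs.1 (hsub ⟨hs.1.le, hs.2.le⟩).2
  have hcont' : ContinuousOn G' (Icc 0 t) :=
    ((continuousOn_const.mul (continuous_im.comp_continuousOn hZ)).div (hZ.norm.pow 2)
      fun s hs ↦ pow_ne_zero 2 (norm_ne_zero_iff.2 (hne s hs))).neg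
  have hFTC := integral_eq_sub_of_hasDerivAt_of_le (NNReal.coe_nonneg t) hcont hderiv
    (hcont'.intervalIntegrable_of_Icc (NNReal.coe_nonneg t))
  have hcongr : ∫ s in (0 : ℝ)..t, 2 * (centredMap W s.toNNReal z).im / ‖centredMap W s.toNNReal z‖ ^ 2 =
      ∫ s in (0 : ℝ)..t, -G' s := by
    refine integral_congr fun s hs ↦ ?_
    rw [uIcc_of_le (NNReal.coe_nonneg t)] at hs
    have hsT : (s.toNNReal : WithTop ℝ≥0) < swallowingTime W z := (hsub hs).2
    simp only [hG', neg_neg]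
    rw [centredMap_eq_of_isSolution hW hg hsT, Real.coe_toNNReal _ hs.1]
  have hG0 : G 0 = z.im := by simp [hG, hg.1]
  rw [hcongr, intervalIntegral.integral_neg, hFTC, hG0, centredMap_eq_of_isSolution hW hg ht]
  simp only [hG, sub_im, ofReal_im]
  ring

/-- **`1/yₜ = 1/Im z + ∫₀ᵗ 2/(yₛ |zₛ|²) ds`** for `z ∈ ℍ`, `t < T_z`: `y` is `C¹` with
`ẏ = -2y/|z|²` and stays positive, so `(1/y)˙ = 2/(y |z|²)`. The finite-variation factor of the
slope `wₜ = xₜ · (1/yₜ)` in the product-rule step of the Itô computation for `Ĝ(zₜ) = h(wₜ)`.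
Rohde–Schramm (2005), proof of Lemma 6.3 (`w(u) = xₜ/yₜ`, `u = log yₜ`, p. 904).
[cite: RohdeSchramm2005, Lemma 6.3] -/
theorem inv_im_centredMap_eq {t : ℝ≥0} (ht : (t : WithTop ℝ≥0) < swallowingTime W z) :
    ((centredMap W t z).im)⁻¹ = (z.im)⁻¹ +
      ∫ s in (0 : ℝ)..t, 2 / ((centredMap W s.toNNReal z).im * ‖centredMap W s.toNNReal z‖ ^ 2) := by
  have hzW : z ≠ W 0 := ne_driving_of_im_pos hz 0
  obtain ⟨g, hg⟩ := exists_isSolution_swallowingTime_holds hW hzW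
  have ht' : ((t : ℝ).toNNReal : WithTop ℝ≥0) < swallowingTime W z := by simpa using ht
  have hsub := Icc_subset_timeDomain ht'
  have hWc : Continuous fun s : ℝ ↦ (W s.toNNReal : ℂ) :=
    continuous_ofReal.comp (hW.comp continuous_real_toNNReal)
  have hZ : ContinuousOn (fun s ↦ g s - (W s.toNNReal : ℂ)) (Icc 0 t) :=
    (hg.continuousOn.mono hsub).sub hWc.continuousOn
  have hne : ∀ s ∈ Icc (0 : ℝ) t, g s - (W s.toNNReal : ℂ) ≠ 0 := fun s hs ↦
    sub_ne_zero.2 (hg.ne hs.1 (hsub hs).2)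
  -- `Im g > 0` on `[0, t]`
  have hpos : ∀ s ∈ Icc (0 : ℝ) t, 0 < (g s).im := fun s hs ↦
    IsSolution.im_pos_holds hW hg hz s hs.1 (hsub hs).2
  have him_eq : ∀ s, (g s - (W s.toNNReal : ℂ)).im = (g s).im := fun s ↦ by simp
  set G : ℝ → ℝ := fun s ↦ ((g s).im)⁻¹ with hG
  set G' : ℝ → ℝ := fun s ↦ 2 / ((g s - W s.toNNReal).im * ‖g s - (W s.toNNReal : ℂ)‖ ^ 2) with hG'
  have hcontIm : ContinuousOn (fun s ↦ (g s).im) (Icc 0 t) :=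
    continuous_im.comp_continuousOn (hg.continuousOn.mono hsub)
  have hcont : ContinuousOn G (Icc 0 t) := hcontIm.inv₀ fun s hs ↦ (hpos s hs).ne'
  have hderiv : ∀ s ∈ Ioo (0 : ℝ) t, HasDerivAt G (G' s) s := by
    intro s hs
    have hsI : s ∈ Icc (0 : ℝ) t := ⟨hs.1.le, hs.2.le⟩
    have h1 := (hg.hasDerivAt_im_interior hs.1 (hsub hsI).2).inv (hpos s hsI).ne'
    refine h1.congr_deriv ?_
    simp only [hG', him_eq]
    have hy : (g s).im ≠ 0 := (hpos s hsI).ne'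
    have hn : ‖g s - (W s.toNNReal : ℂ)‖ ^ 2 ≠ 0 := pow_ne_zero 2 (norm_ne_zero_iff.2 (hne s hsI))
    field_simp
  have hcont' : ContinuousOn G' (Icc 0 t) := by
    refine continuousOn_const.div (((continuous_im.comp_continuousOn hZ)).mul (hZ.norm.pow 2)) ?_
    intro s hs
    rw [him_eq]
    exact mul_ne_zero (hpos s hs).ne' (pow_ne_zero 2 (norm_ne_zero_iff.2 (hne s hs)))
  have hFTC := integral_eq_sub_of_hasDerivAt_of_le (NNReal.coe_nonneg t) hcont hderiv
    (hcont'.intervalIntegrable_of_Icc (NNReal.coe_nonneg t))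
  have hcongr : ∫ s in (0 : ℝ)..t, 2 / ((centredMap W s.toNNReal z).im * ‖centredMap W s.toNNReal z‖ ^ 2) =
      ∫ s in (0 : ℝ)..t, G' s := by
    refine integral_congr fun s hs ↦ ?_
    rw [uIcc_of_le (NNReal.coe_nonneg t)] at hs
    have hsT : (s.toNNReal : WithTop ℝ≥0) < swallowingTime W z := (hsub hs).2
    simp only [hG']
    rw [centredMap_eq_of_isSolution hW hg hsT, Real.coe_toNNReal _ hs.1]
  have hG0 : G 0 = (z.im)⁻¹ := by simp [hG, hg.1]
  have hGt : (centredMap W t z).im = (g t).im := by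
    rw [centredMap_eq_of_isSolution hW hg ht]; simp
  rw [hcongr, hFTC, hG0, hGt]
  simp only [hG]
  ring

/-- **`ψₜ^a = 1 + ∫₀ᵗ a ψₛ^a (4yₛ²/|zₛ|⁴) ds`** for `z ∈ ℍ`, `t < T_z` and every real exponent `a`
(`ψₛ = derivRatio W z s`, rate `derivRatioRate W z s = 4yₛ²/|zₛ|⁴`): by (6.3),
`ψₜ = exp ∫₀ᵗ 4y²/|z|⁴` (`derivRatio_eq_exp`), so `ψ^a = exp(a ∫ rate)` is `C¹` with derivative
`a · rate · ψ^a`. This is the factor `(ŷ |gₜ'(ẑ)|/yₜ)^a` of `Mₜ` (Rohde–Schramm (2005), proof of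
Lemma 6.3, p. 904: "`∂ₜ log |gₜ'(z)/yₜ| = 4yₜ²|zₜ|⁻⁴`"). [cite: RohdeSchramm2005, eq. (6.3)] -/
theorem derivRatio_rpow_eq (a : ℝ) {t : ℝ≥0} (ht : (t : WithTop ℝ≥0) < swallowingTime W z) :
    derivRatio W z t ^ a = 1 +
      ∫ s in (0 : ℝ)..t, a * derivRatioRate W z s * derivRatio W z s.toNNReal ^ a := by
  have ht' : ((t : ℝ).toNNReal : WithTop ℝ≥0) < swallowingTime W z := by simpa using ht
  have hsub := Icc_subset_timeDomain ht'
  -- the rate is continuous on `[0, t]`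
  have hrate : ContinuousOn (derivRatioRate W z) (Icc 0 t) := continuousOn_derivRatioRate hW ht'
  -- `R s = ∫₀ˢ rate`, `F s = exp (a R s)`
  set R : ℝ → ℝ := fun s ↦ ∫ u in (0 : ℝ)..s, derivRatioRate W z u with hR
  set F : ℝ → ℝ := fun s ↦ Real.exp (a * R s) with hF
  have hRint : ∀ s ∈ Icc (0 : ℝ) t, IntervalIntegrable (derivRatioRate W z) volume 0 s := fun s hs ↦
    (hrate.mono (by rw [uIcc_of_le hs.1]; exact Icc_subset_Icc_right hs.2)).intervalIntegrable
  have hRderiv : ∀ s ∈ Ioo (0 : ℝ) t, HasDerivAt R (derivRatioRate W z s) s := by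
    intro s hs
    have hsI : s ∈ Icc (0 : ℝ) t := ⟨hs.1.le, hs.2.le⟩
    have hnhds : Icc (0 : ℝ) t ∈ 𝓝 s := Icc_mem_nhds hs.1 hs.2
    have hca : ContinuousAt (derivRatioRate W z) s := hrate.continuousAt hnhds
    have hmeas : StronglyMeasurableAtFilter (derivRatioRate W z) (𝓝 s) volume :=
      (hrate.mono Ioo_subset_Icc_self).stronglyMeasurableAtFilter isOpen_Ioo s hs
    exact integral_hasDerivAt_right (hRint s hsI) hmeas hca
  have hRcont : ContinuousOn R (Icc 0 t) := by
    have h := (continuousOn_primitive_interval' (hRint t ⟨NNReal.coe_nonneg t, le_rfl⟩)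
      (by rw [uIcc_of_le (NNReal.coe_nonneg t)]; exact ⟨le_rfl, NNReal.coe_nonneg t⟩))
    rw [uIcc_of_le (NNReal.coe_nonneg t)] at h
    exact h
  have hFcont : ContinuousOn F (Icc 0 t) :=
    Real.continuous_exp.comp_continuousOn (continuousOn_const.mul hRcont)
  have hFderiv : ∀ s ∈ Ioo (0 : ℝ) t, HasDerivAt F (a * derivRatioRate W z s * F s) s := by
    intro s hs
    have h1 := ((hRderiv s hs).const_mul a).exp
    refine h1.congr_deriv ?_
    simp only [hF]
    ring
  have hcont' : ContinuousOn (fun s ↦ a * derivRatioRate W z s * F s) (Icc 0 t) :=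
    (continuousOn_const.mul hrate).mul hFcont
  have hFTC := integral_eq_sub_of_hasDerivAt_of_le (NNReal.coe_nonneg t) hFcont hFderiv
    (hcont'.intervalIntegrable_of_Icc (NNReal.coe_nonneg t))
  -- `F s = ψₛ^a` on `[0, t]`
  have hFψ : ∀ s ∈ Icc (0 : ℝ) t, F s = derivRatio W z s.toNNReal ^ a := by
    intro s hs
    have hsT : (s.toNNReal : WithTop ℝ≥0) < swallowingTime W z := (hsub hs).2
    simp only [hF, hR]
    rw [derivRatio_eq_exp hW hz hsT, Real.coe_toNNReal _ hs.1, ← Real.exp_mul, mul_comm]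
  have hcongr : ∫ s in (0 : ℝ)..t, a * derivRatioRate W z s * derivRatio W z s.toNNReal ^ a =
      ∫ s in (0 : ℝ)..t, a * derivRatioRate W z s * F s := by
    refine integral_congr fun s hs ↦ ?_
    rw [uIcc_of_le (NNReal.coe_nonneg t)] at hs
    simp only [hFψ s hs]
  have hF0 : F 0 = 1 := by simp [hF, hR]
  have hFt : F t = derivRatio W z t ^ a := by
    rw [hFψ t ⟨NNReal.coe_nonneg t, le_rfl⟩, Real.toNNReal_coe]
  rw [hcongr, hFTC, hF0, hFt]
  ring

end Integrated

end Loewner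

end Literature.Probability.RandomPlanarGeometry

end
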